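import Summits.HodgeConjecture.HodgeConjecture.Theses.KugaSatakeSaturation
import Literature.AlgebraicGeometry.Motives.HodgeTensorFactsHolds

/-!
# Crux `TwistGeneration` (stmt-HodgeConjecture-17602) — line `mt_dictionary` (birth skeleton)

`TwistGeneration`: every Hodge map `μ ∈ M = Hom_Hdg(T(1), End KS~)` lies in the `ℚ`-span `G` of the
one-sided generators `t ↦ L_{ι(e t)} ∘ b'`, `e ∈ End_Hdg(T)`, `b' ∈ 𝔅 = End_Hdg(KS~)`.

Line (the representation-theoretic proof cut at its three joints, at the level of `ℚ`-POINTS of the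
lifted Hodge group `G~(ℚ) = {g ∈ C even unit, g ι(T) g⁻¹ = ι(T), inducing γ ∈ Hdg(T)(ℚ)}` — tree
`hodgeGroup`, instance `hodgeTensorFacts_holds`):
* `stub_hodgeMaps_equivariant` (D1): `μ ∈ M` is `G~(ℚ)`-equivariant (`MT(KS~)` = full spin preimage);
* `stub_commutant_preserves` (D2): the commutant of `G~(ℚ)` preserves `F¹_KS` (density, `J ∈ G~(ℝ)`);
* `stub_invariant_theory` (D3, heart): equivariant `μ` ∈ span{`L_{ι(e ·)} ∘ b'` : `b'` in the
  commutant} (Zarhin, slot count over `ℚ̄`, descent).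
Gate shape: stub statements = local defs; `sorry` only in the three `stub_*`;
`twistGeneration_of_pieces` sorry-free (verbatim conclusion, `Submodule.span_mono`);
`TwistGeneration_of : TwistGeneration` by name. (Same stubs as D1–D3 of the parent line
`Saturation/Lines/twist_split`.)
-/

set_option linter.dupNamespace false

namespace Summit.HodgeConjecture.HodgeConjecture.Cruxes.TwistGeneration.MTDictionary

open Literature.AlgebraicGeometry.Motives
open Summit.HodgeConjecture.HodgeConjecture.Theses.KugaSatakeSaturation

/-- D1. [cite: vanGeemen2000KugaSatakeHC, Prop. 6.3] [cite: Huybrechts2016K3, Ch. 4 Prop. 2.6] -/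
def HodgeMapsEquivariant : Prop :=
  ∀ (T : Type) [AddCommGroup T] [Module ℚ T] [Module.Finite ℚ T] [HodgeTensorFacts.{0, 0}] (H : HodgeStructure T 2) (P : H.Polarization), H.F 3 = ⊥ → H.hodgeNumber 2 0 = 1 → (∀ t : T, HodgeStructure.ofRat t ∈ H.F 1 → t = 0) → ∀ μ : T →ₗ[ℚ] Module.End ℚ (CliffordAlgebra (LinearMap.BilinMap.toQuadraticMap P.form)), (∀ w ∈ H.F 1, let g := HodgeStructure.homBaseChange _ _ (μ.baseChange ℂ w); (Submodule.map ((CliffordAlgebra.ι (LinearMap.BilinMap.toQuadraticMap P.form)).baseChange ℂ) (H.piece 2 0) * ⊤).map g ≤ (Submodule.map ((CliffordAlgebra.ι (LinearMap.BilinMap.toQuadraticMap P.form)).baseChange ℂ) (H.piece 2 0) * ⊤) ∧ (w ∈ H.piece 2 0 → LinearMap.range g ≤ (Submodule.map ((CliffordAlgebra.ι (LinearMap.BilinMap.toQuadraticMap P.form)).baseChange ℂ) (H.piece 2 0) * ⊤) ∧ (Submodule.map ((CliffordAlgebra.ι (LinearMap.BilinMap.toQuadraticMap P.form)).baseChange ℂ)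 (H.piece 2 0) * ⊤).map g = ⊥)) → (∀ (g : CliffordAlgebra (LinearMap.BilinMap.toQuadraticMap P.form)) (γ : T ≃ₗ[ℚ] T), IsUnit g → g ∈ CliffordAlgebra.evenOdd (LinearMap.BilinMap.toQuadraticMap P.form) 0 → (∀ t : T, g * CliffordAlgebra.ι (LinearMap.BilinMap.toQuadraticMap P.form) t = CliffordAlgebra.ι (LinearMap.BilinMap.toQuadraticMap P.form) (γ t) * g) → γ ∈ H.hodgeGroup → ∀ t : T, μ (γ t) ∘ₗ LinearMap.mulLeft ℚ g = LinearMap.mulLeft ℚ g ∘ₗ μ t)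

/-- D2. [cite: vanGeemen2000KugaSatakeHC, Lemma 5.5 and Prop. 5.7] -/
def CommutantPreserves : Prop :=
  ∀ (T : Type) [AddCommGroup T] [Module ℚ T] [Module.Finite ℚ T] [HodgeTensorFacts.{0, 0}] (H : HodgeStructure T 2) (P : H.Polarization), H.F 3 = ⊥ → H.hodgeNumber 2 0 = 1 → (∀ t : T, HodgeStructure.ofRat t ∈ H.F 1 → t = 0) → ∀ b : Module.End ℚ (CliffordAlgebra (LinearMap.BilinMap.toQuadraticMap P.form)), (∀ (g : CliffordAlgebra (LinearMap.BilinMap.toQuadraticMap P.form)) (γ : T ≃ₗ[ℚ] T), IsUnit g → g ∈ CliffordAlgebra.evenOdd (LinearMap.BilinMap.toQuadraticMap P.form) 0 → (∀ t : T, g * CliffordAlgebra.ι (LinearMap.BilinMap.toQuadraticMap P.form) t = CliffordAlgebra.ι (LinearMap.BilinMap.toQuadraticMap P.form) (γ t) * g) → γ ∈ H.hodgeGroup → b ∘ₗ LinearMap.mulLeft ℚ g = LinearMap.mulLeft ℚ g ∘ₗ b) → (Submodule.map ((CliffordAlgebra.ι (LinearMap.BilinMap.toQuadraticMap P.form)).baseChange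 ℂ) (H.piece 2 0) * ⊤).map (b.baseChange ℂ) ≤ (Submodule.map ((CliffordAlgebra.ι (LinearMap.BilinMap.toQuadraticMap P.form)).baseChange ℂ) (H.piece 2 0) * ⊤)

/-- D3 (heart). [cite: Zarhin1983HodgeGroupsK3, Thm. 2.2.1 and 2.3.1] [cite: VanGeemen2008RM, §5–6] -/
def InvariantTheory : Prop :=
  ∀ (T : Type) [AddCommGroup T] [Module ℚ T] [Module.Finite ℚ T] [HodgeTensorFacts.{0, 0}] (H : HodgeStructure T 2) (P : H.Polarization), H.F 3 = ⊥ → H.hodgeNumber 2 0 = 1 → (∀ t : T, HodgeStructure.ofRat t ∈ H.F 1 → t = 0) → ∀ μ : T →ₗ[ℚ] Module.End ℚ (CliffordAlgebra (LinearMap.BilinMap.toQuadraticMap P.form)), (∀ (g : CliffordAlgebra (LinearMap.BilinMap.toQuadraticMap P.form)) (γ : T ≃ₗ[ℚ] T), IsUnit g → g ∈ CliffordAlgebra.evenOdd (LinearMap.BilinMap.toQuadraticMap P.form) 0 → (∀ t : T, g * CliffordAlgebra.ι (LinearMap.BilinMap.toQuadraticMap P.form) t = CliffordAlgebra.ι (LinearMap.BilinMap.toQuadraticMap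 P.form) (γ t) * g) → γ ∈ H.hodgeGroup → ∀ t : T, μ (γ t) ∘ₗ LinearMap.mulLeft ℚ g = LinearMap.mulLeft ℚ g ∘ₗ μ t) → μ ∈ Submodule.span ℚ {ν : T →ₗ[ℚ] Module.End ℚ (CliffordAlgebra (LinearMap.BilinMap.toQuadraticMap P.form)) | ∃ (e : H.Hom H) (b' : Module.End ℚ (CliffordAlgebra (LinearMap.BilinMap.toQuadraticMap P.form))), (∀ (g : CliffordAlgebra (LinearMap.BilinMap.toQuadraticMap P.form)) (γ : T ≃ₗ[ℚ] T), IsUnit g → g ∈ CliffordAlgebra.evenOdd (LinearMap.BilinMap.toQuadraticMap P.form) 0 → (∀ t : T, g * CliffordAlgebra.ι (LinearMap.BilinMap.toQuadraticMap P.form) t = CliffordAlgebra.ι (LinearMap.BilinMap.toQuadraticMap P.form) (γ t) * g) → γ ∈ H.hodgeGroup → b' ∘ₗ LinearMap.mulLeft ℚ g = LinearMap.mulLeft ℚ g ∘ₗ b') ∧ ∀ t, ν t = LinearMap.mulLeft ℚ ((CliffordAlgebra.ι (LinearMap.BilinMap.toQuadraticMap P.form)) (e.toLinearMap t)) ∘ₗ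 b'}

/-- STUB D1 (size M/L). [cite: vanGeemen2000KugaSatakeHC, Prop. 6.3] -/
theorem stub_hodgeMaps_equivariant : HodgeMapsEquivariant := by
  sorry

/-- STUB D2 (size M). [cite: vanGeemen2000KugaSatakeHC, Lemma 5.5 and Prop. 5.7] -/
theorem stub_commutant_preserves : CommutantPreserves := by
  sorry

/-- STUB D3 (size L, hardest). [cite: Zarhin1983HodgeGroupsK3, Thm. 2.2.1 and 2.3.1] -/
theorem stub_invariant_theory : InvariantTheory := by
  sorry

/-- Composition (sorry-free, verbatim conclusion). [cite: vanGeemen2000KugaSatakeHC, §6] -/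
theorem twistGeneration_of_pieces (h₁ : HodgeMapsEquivariant) (h₂ : CommutantPreserves)
    (h₃ : InvariantTheory) :
    ∀ (T : Type) [AddCommGroup T] [Module ℚ T] [Module.Finite ℚ T] (H : HodgeStructure T 2) (P : H.Polarization), H.F 3 = ⊥ → H.hodgeNumber 2 0 = 1 → (∀ t : T, HodgeStructure.ofRat t ∈ H.F 1 → t = 0) → ∀ μ : T →ₗ[ℚ] Module.End ℚ (CliffordAlgebra (LinearMap.BilinMap.toQuadraticMap P.form)), (∀ w ∈ H.F 1, let g := HodgeStructure.homBaseChange _ _ (μ.baseChange ℂ w); (Submodule.map ((CliffordAlgebra.ι (LinearMap.BilinMap.toQuadraticMap P.form)).baseChange ℂ) (H.piece 2 0) * ⊤).map g ≤ (Submodule.map ((CliffordAlgebra.ι (LinearMap.BilinMap.toQuadraticMap P.form)).baseChange ℂ) (H.piece 2 0) * ⊤) ∧ (w ∈ H.piece 2 0 → LinearMap.range g ≤ (Submodule.map ((CliffordAlgebra.ι (LinearMap.BilinMap.toQuadraticMap P.form)).baseChange ℂ) (H.piece 2 0) * ⊤) ∧ (Submodule.map ((CliffordAlgebra.ι (LinearMap.BilinMap.toQuadraticMap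 P.form)).baseChange ℂ) (H.piece 2 0) * ⊤).map g = ⊥)) → μ ∈ Submodule.span ℚ {ν : T →ₗ[ℚ] Module.End ℚ (CliffordAlgebra (LinearMap.BilinMap.toQuadraticMap P.form)) | ∃ (e : H.Hom H) (b' : Module.End ℚ (CliffordAlgebra (LinearMap.BilinMap.toQuadraticMap P.form))), (Submodule.map ((CliffordAlgebra.ι (LinearMap.BilinMap.toQuadraticMap P.form)).baseChange ℂ) (H.piece 2 0) * ⊤).map (b'.baseChange ℂ) ≤ (Submodule.map ((CliffordAlgebra.ι (LinearMap.BilinMap.toQuadraticMap P.form)).baseChange ℂ) (H.piece 2 0) * ⊤) ∧ ∀ t, ν t = LinearMap.mulLeft ℚ ((CliffordAlgebra.ι (LinearMap.BilinMap.toQuadraticMap P.form)) (e.toLinearMap t)) ∘ₗ b'} := by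
  intro T _ _ _ H P hF3 h20 hirr μ hμ
  haveI : HodgeTensorFacts.{0, 0} := hodgeTensorFacts_holds
  have hequiv := h₁ T H P hF3 h20 hirr μ hμ
  have hspan := h₃ T H P hF3 h20 hirr μ hequiv
  refine Submodule.span_mono ?_ hspan
  rintro ν ⟨e, b', hb', hν⟩
  exact ⟨e, b', h₂ T H P hF3 h20 hirr b' hb', hν⟩

/-- **THE SKELETON THEOREM**: the route decl `TwistGeneration` by name from the three declared stubs.
[cite: Zarhin1983HodgeGroupsK3, Thm. 2.2.1 and 2.3.1] -/
theorem TwistGeneration_of : TwistGeneration :=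
  twistGeneration_of_pieces stub_hodgeMaps_equivariant stub_commutant_preserves stub_invariant_theory

end Summit.HodgeConjecture.HodgeConjecture.Cruxes.TwistGeneration.MTDictionary
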